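import Literature.Computability.Cryptography.OrderFindingPostEuclid
import Literature.Computability.Cryptography.IrrationalPeriodRecovery
import Literature.Computability.Complexity.CodeFPBudgets
import HarnessLib

/-!
# All convergent numerators of a fraction, in polynomial time; the recovery of an irrational period

Topic `Computability/Cryptography`; the classical post-processing step of Hallgren's period finding
(Jozsa 2003, §10, proof of Thm. 6: from two samples `c ≈ kq/S`, `d ≈ lq/S` with `gcd(k, l) = 1`,
"`k/l` is a convergent of `c/d`, which then gives `k` as the numerator of a convergent", and
`S ≈ kq/c`), built on the tree's Euclid/continuant machinery (`OFPostCF.quots`, `evalFrac`,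
`cfFwd`, `natConv_eq_convergent` of `OrderFindingPostSpec.lean`, `OFPostB.quots_succ`,
`evalFrac_quots_le` of `OrderFindingPostEuclid.lean`) and on `IrrationalPeriodRecovery.lean`.
Unlike Shor's scan (`OFPostB.cfNext`: the FIRST convergent passing a denominator test), Hallgren's
post-processor must try EVERY convergent numerator, so we list them all:

* `numsOf l` — the numerators `p₁, …, p_{|l|}` of the prefixes of a quotient list; `convStep`,
  `convRun` (Euclid + forward recurrence + output, one quotient per unit of fuel), `convRun_spec`;
* **`codeFP_convNums`** — `(A, D, 1ᶠ) ↦ numsOf (quots A D f)` in the typed algebra `CodeFP`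
  (accumulator bounded by `max A D`, `evalFrac_quots_le`);
* `mem_numsOf_of_prefix`, `num_eq_of_div_eq_div` (lowest terms), and **`exists_mem_numsOf_round`**
  (Jozsa's recovery): under the hypotheses of `IrrationalPeriod.exists_convergent_eq`
  (`q ≥ 3S²`, `1 ≤ k, l ≤ S`, coprime, samples within `1/2`), some listed numerator `p` of `c/d`
  (fuel `2s + 1`, `d < 2ˢ`) has `|S − round(pq/c)| < 1` — indeed `p = k`.

## References

* R. Jozsa, arXiv:quant-ph/0302134 (2003), §10 (proof of Thm. 6, Lemma 2). [Jozsa2003]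
* G. H. Hardy, E. M. Wright, *An Introduction to the Theory of Numbers*, §10.2 Thm. 149, §10.15
  Thm. 184. [HardyWright2008]
* S. Arora, B. Barak, *Computational Complexity*, CUP 2009, §1.3. [AroraBarak2009]
-/

noncomputable section

namespace Literature.Computability.Cryptography

namespace PeriodFinding

open _root_.Computability Complexity Complexity.CodeFP OFPostCF OFPostB Polynomial

/-! ### The numerators of the prefixes -/

/-- The numerators of the convergents of the nonempty prefixes of a quotient list. [cite: HardyWright2008, §10.2 Thm. 149] -/
def numsOf (l : List ℕ) : List ℕ := (List.range l.length).map fun i => (cfFwd (l.take (i + 1))).1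

/-- `numsOf` of an extended list. [folklore] -/
theorem numsOf_append_singleton (l : List ℕ) (a : ℕ) : numsOf (l ++ [a]) = numsOf l ++ [(cfFwd (l ++ [a])).1] := by
  unfold numsOf
  rw [List.length_append, List.length_singleton, List.range_succ, List.map_append, List.map_singleton]
  congr 1
  · refine List.map_congr_left fun i hi => ?_
    rw [List.mem_range] at hi
    rw [List.take_append_of_le_length (by omega)]
  · rw [List.take_of_length_le (by simp)]

/-- A numerator of a nonempty prefix is listed. [folklore] -/
theorem mem_numsOf_of_prefix {l l' : List ℕ} (h : l' <+: l) (hne : l' ≠ []) : (cfFwd l').1 ∈ numsOf l := by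
  unfold numsOf
  rw [List.mem_map]
  obtain ⟨t, rfl⟩ := h
  have hlen : 0 < l'.length := List.length_pos_iff.mpr hne
  refine ⟨l'.length - 1, List.mem_range.2 (by simp; omega), ?_⟩
  rw [show l'.length - 1 + 1 = l'.length by omega, List.take_left']
  rfl

/-! ### The loop -/

/-- The loop state: Euclid's pair, the continuant state `(p₁, q₁, p₀, q₀)`, the numerators so far. [folklore] -/
abbrev CSt : Type := (ℕ × ℕ) × (ℕ × ℕ × ℕ × ℕ) × List ℕ

/-- One round: the next quotient (if Euclid has not stopped), the forward recurrence, the output. [cite: HardyWright2008, §10.2 Thm. 149] -/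
def convStep (s : CSt) : CSt :=
  if s.1.2 = 0 then s
  else ((s.1.2, s.1.1 % s.1.2), cfStep s.2.1 (s.1.1 / s.1.2), s.2.2 ++ [(cfStep s.2.1 (s.1.1 / s.1.2)).1])

/-- `f` rounds from `((A, D), (1, 0, 0, 1), [])`. [folklore] -/
def convRun (A D f : ℕ) : CSt := (convStep)^[f] ((A, D), (1, 0, 0, 1), [])

/-- **The loop computes Euclid's pair, the continuants and the numerators of all prefixes.** [cite: HardyWright2008, §10.2 Thm. 149] -/
theorem convRun_spec (A D : ℕ) : ∀ f : ℕ,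
    convRun A D f = (euclidStep^[f] (A, D), cfFwd (quots A D f), numsOf (quots A D f))
  | 0 => by simp [convRun, cfFwd, quots, numsOf]
  | f + 1 => by
    rw [convRun, Function.iterate_succ_apply', ← convRun, convRun_spec A D f, quots_succ,
      Function.iterate_succ_apply']
    set p := euclidStep^[f] (A, D) with hp
    by_cases hb : p.2 = 0
    · rw [if_pos hb, List.append_nil]
      simp [convStep, euclidStep, hb]
    · rw [if_neg hb, numsOf_append_singleton]
      have hcf : cfFwd (quots A D f ++ [p.1 / p.2]) = cfStep (cfFwd (quots A D f)) (p.1 / p.2) := by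
        rw [cfFwd, cfFwd, List.foldl_append]; rfl
      have he : euclidStep p = (p.2, p.1 % p.2) := by simp [euclidStep, hb]
      rw [hcf, he]
      simp only [convStep, hb, if_false]

/-! ### Size along the loop -/

/-- The continuant state is bounded by the convergents of the full expansion. [folklore] -/
theorem cfFwd_quots_le (A D f : ℕ) :
    (cfFwd (quots A D f)).1 ≤ max A 1 ∧ (cfFwd (quots A D f)).2.1 ≤ max D 1 ∧
      (cfFwd (quots A D f)).2.2.1 ≤ max A 1 ∧ (cfFwd (quots A D f)).2.2.2 ≤ max D 1 := by
  induction f with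
  | zero => simp [quots, cfFwd]
  | succ f ih =>
    obtain ⟨h1, h2, h3, h4⟩ := ih
    have hcur := evalFrac_quots_le (f + 1) A D
    rw [← cfFwd_eq_evalFrac] at hcur
    obtain ⟨hc1, hc2⟩ := hcur
    refine ⟨hc1, hc2, ?_, ?_⟩
    · rw [quots_succ]
      split_ifs
      · rw [List.append_nil]; exact h3
      · rw [cfFwd, List.foldl_append, ← cfFwd]; simp only [List.foldl_cons, List.foldl_nil, cfStep]; exact h1
    · rw [quots_succ]
      split_ifs
      · rw [List.append_nil]; exact h4
      · rw [cfFwd, List.foldl_append, ← cfFwd]; simp only [List.foldl_cons, List.foldl_nil, cfStep]; exact h2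

/-- **Prefixes of an Euclid expansion are Euclid expansions with less fuel.** [folklore] -/
theorem take_quots : ∀ (f m a b : ℕ), m ≤ f → (quots a b f).take m = quots a b m
  | f, 0, a, b, _ => by simp [quots]
  | 0, m + 1, a, b, h => absurd h (by omega)
  | f + 1, m + 1, a, b, h => by
    simp only [quots]
    split_ifs with hb
    · simp
    · rw [List.take_succ_cons, take_quots f m b (a % b) (by omega)]

/-- Listed numerators are `≤ max A 1`. [folklore] -/
theorem mem_numsOf_quots_le {A D f p : ℕ} (hp : p ∈ numsOf (quots A D f)) : p ≤ max A 1 := by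
  unfold numsOf at hp
  rw [List.mem_map] at hp
  obtain ⟨i, hi, rfl⟩ := hp
  rw [List.mem_range] at hi
  have hif : i + 1 ≤ f := by have := length_quots_le_fuel A D f; omega
  rw [take_quots f (i + 1) A D hif]
  exact (cfFwd_quots_le A D (i + 1)).1

/-- The list has at most `f` entries. [folklore] -/
theorem length_numsOf_quots_le (A D f : ℕ) : (numsOf (quots A D f)).length ≤ f := by
  unfold numsOf
  rw [List.length_map, List.length_range]
  exact length_quots_le_fuel A D f

/-! ### The program -/

/-- The code of the loop state. [folklore] -/
abbrev cstE : CSt → List Bool := pairE (pairE natE natE) (pairE (pairE natE (pairE natE (pairE natE natE))) (rawE natE))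

/-- **One round on codes.** [cite: AroraBarak2009, §1.3] -/
theorem codeFP_convStep : CodeFP cstE cstE convStep := by
  have ha : CodeFP cstE natE (fun s => s.1.1) := (fst _ _).fst'
  have hb : CodeFP cstE natE (fun s => s.1.2) := (fst _ _).snd'
  have hst : CodeFP cstE (pairE natE (pairE natE (pairE natE natE))) (fun s => s.2.1) := (snd _ _).fst'
  have hl : CodeFP cstE (rawE natE) (fun s => s.2.2) := (snd _ _).snd'
  have hq : CodeFP cstE natE (fun s => s.1.1 / s.1.2) := (natDiv.comp (ha.pair hb) :)
  have hp1 : CodeFP cstE natE (fun s => s.2.1.1) := hst.fst'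
  have hq1 : CodeFP cstE natE (fun s => s.2.1.2.1) := hst.snd'.fst'
  have hp0 : CodeFP cstE natE (fun s => s.2.1.2.2.1) := hst.snd'.snd'.fst'
  have hq0 : CodeFP cstE natE (fun s => s.2.1.2.2.2) := hst.snd'.snd'.snd'
  have hnp : CodeFP cstE natE (fun s => s.1.1 / s.1.2 * s.2.1.1 + s.2.1.2.2.1) := (natAdd.comp ((natMul.comp (hq.pair hp1)).pair hp0) :)
  have hnq : CodeFP cstE natE (fun s => s.1.1 / s.1.2 * s.2.1.2.1 + s.2.1.2.2.2) := (natAdd.comp ((natMul.comp (hq.pair hq1)).pair hq0) :)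
  have hcf : CodeFP cstE (pairE natE (pairE natE (pairE natE natE))) (fun s => cfStep s.2.1 (s.1.1 / s.1.2)) :=
    ((hnp.pair (hnq.pair (hp1.pair hq1))).congr fun s => rfl)
  have hnew : CodeFP cstE cstE (fun s => ((s.1.2, s.1.1 % s.1.2), cfStep s.2.1 (s.1.1 / s.1.2),
      s.2.2 ++ [(cfStep s.2.1 (s.1.1 / s.1.2)).1])) :=
    ((hb.pair (natMod.comp (ha.pair hb) :)).pair (hcf.pair ((rawAppend natE).comp (hl.pair ((rawSingleton natE).comp hcf.fst')) :)) :)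
  have hc : CodeFP cstE bitE (fun s => decide (s.1.2 = 0)) := (natEq.comp (hb.pair (const _ (0 : ℕ))) :)
  refine ((hc.ite (CodeFP.id cstE) hnew).congr fun s => ?_)
  unfold convStep
  by_cases h : s.1.2 = 0 <;> simp [h]

/-- `size (x + 1) ≤ size x + 1`. [folklore] -/
theorem size_succ_le (x : ℕ) : (x + 1).size ≤ x.size + 1 :=
  Nat.size_le.mpr (lt_of_le_of_lt (Nat.succ_le_of_lt (Nat.lt_size_self x)) (Nat.pow_lt_pow_right (by norm_num) (by omega)))

/-- Length of the code of the state after `f` rounds: linear in `f` and in the sizes of `A`, `D`. [folklore] -/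
theorem length_cstE_le (A D f : ℕ) :
    (cstE (convRun A D f)).length ≤ (2 * f + 20) * ((natE A).length + (natE D).length + 4) := by
  rw [convRun_spec]
  obtain ⟨e1, e2, e3⟩ := euclidStep_iterate_le A D f
  obtain ⟨c1, c2, c3, c4⟩ := cfFwd_quots_le A D f
  set M := (natE A).length + (natE D).length + 1 with hM
  have hmono : ∀ {x : ℕ}, x ≤ max A D + 1 → (natE x).length ≤ M := fun {x} hx => by
    rw [hM, length_natE, length_natE, length_natE]
    have h1 := Nat.size_le_size hx
    have h2 := size_succ_le (max A D)
    have h3 : (max A D).size ≤ A.size + D.size := by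
      rcases le_total A D with h | h
      · rw [max_eq_right h]; omega
      · rw [max_eq_left h]; omega
    omega
  have hA1 : max A 1 ≤ max A D + 1 := by omega
  have hD1 : max D 1 ≤ max A D + 1 := by omega
  have b1 := hmono (show (euclidStep^[f] (A, D)).1 ≤ max A D + 1 by omega)
  have b2 := hmono (show (euclidStep^[f] (A, D)).2 ≤ max A D + 1 by omega)
  have b3 := hmono (c1.trans hA1)
  have b4 := hmono (c2.trans hD1)
  have b5 := hmono (c3.trans hA1)
  have b6 := hmono (c4.trans hD1)
  have hlist : (rawE natE (numsOf (quots A D f))).length ≤ f * (2 * M + 2) := by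
    rw [length_rawE]
    have hle : ∀ p ∈ numsOf (quots A D f), 2 * (natE p).length + 2 ≤ 2 * M + 2 := fun p hp => by
      have := hmono ((mem_numsOf_quots_le hp).trans hA1); omega
    calc ((numsOf (quots A D f)).map fun p => 2 * (natE p).length + 2).sum
        ≤ ((numsOf (quots A D f)).map fun _ => 2 * M + 2).sum := List.sum_le_sum (by simpa using hle)
      _ = (numsOf (quots A D f)).length * (2 * M + 2) := by rw [List.map_const', List.sum_replicate, smul_eq_mul]
      _ ≤ f * (2 * M + 2) := Nat.mul_le_mul_right _ (length_numsOf_quots_le A D f)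
  simp only [pairE_apply, length_boolPair]
  have hM3 : M + 3 = (natE A).length + (natE D).length + 4 := by rw [hM]
  rw [← hM3]
  nlinarith [hlist, b1, b2, b3, b4, b5, b6]

/-- **All convergent numerators in polynomial time**: `(A, (D, 1ᶠ)) ↦ numsOf (quots A D f)`. [cite: AroraBarak2009, §1.3] [cite: HardyWright2008, §10.2] -/
theorem codeFP_convNums : CodeFP (pairE natE (pairE natE unE)) (rawE natE) (fun c => numsOf (quots c.1 c.2.1 c.2.2)) := by
  have hstep : CodeFP (pairE (pairE natE natE) (pairE unitE cstE)) cstE (fun t => convStep t.2.2) :=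
    codeFP_convStep.comp (snd _ _).snd'
  have hinit : CodeFP (pairE natE natE) cstE (fun s => ((s.1, s.2), ((1 : ℕ), (0 : ℕ), (0 : ℕ), (1 : ℕ)), ([] : List ℕ))) :=
    (((fst _ _).pair (snd _ _)).pair ((const _ ((1 : ℕ), (0 : ℕ), (0 : ℕ), (1 : ℕ))).pair (const _ ([] : List ℕ))) :)
  have h := foldl (σ := ℕ × ℕ) (α := Unit) (β := CSt) (eσ := pairE natE natE) (eα := unitE) (eβ := cstE)
    (step := fun _ _ b => convStep b) (init := fun s => ((s.1, s.2), (1, 0, 0, 1), [])) hstep hinit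
    ((2 * X + 20) * (X + 4))
    (fun s l₁ l₂ => by
      have hit : l₁.foldl (fun b _ => convStep b) ((s.1, s.2), (1, 0, 0, 1), []) = convRun s.1 s.2 l₁.length := by
        rw [convRun]
        induction l₁ using List.reverseRecOn with
        | nil => rfl
        | append_singleton l a ih => rw [List.foldl_append, ih, List.foldl_cons, List.foldl_nil, List.length_append,
            List.length_singleton, Function.iterate_succ_apply']
      rw [hit]
      refine (length_cstE_le s.1 s.2 l₁.length).trans ?_
      simp only [eval_mul, eval_add, eval_ofNat, eval_X]
      have hlen : (pairE (pairE natE natE) (rawE unitE) (s, l₁ ++ l₂)).length ≥ (natE s.1).length + (natE s.2).length + l₁.length := by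
        simp only [pairE_apply, length_boolPair]
        have := length_le_length_rawE unitE (l₁ ++ l₂)
        simp only [List.length_append] at this
        omega
      apply Nat.mul_le_mul <;> omega)
  refine ((h.comp (((fst _ _).pair (snd _ _).fst').pair (replicateUnit.comp (snd _ _).snd'))).snd'.snd'.congr fun c => ?_)
  have hit : ∀ (n : ℕ) (s₀ : CSt), (List.replicate n ()).foldl (fun b _ => convStep b) s₀ = (convStep)^[n] s₀ := by
    intro n s₀
    induction n generalizing s₀ with
    | zero => rfl
    | succ n ih => rw [List.replicate_succ, List.foldl_cons, ih, ← Function.iterate_succ_apply]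
  show ((List.replicate c.2.2 ()).foldl (fun b _ => convStep b) ((c.1, c.2.1), (1, 0, 0, 1), [])).2.2 =
    numsOf (quots c.1 c.2.1 c.2.2)
  rw [hit, ← convRun, convRun_spec]

/-! ### Recovery of the period -/

/-- Lowest-terms numerators agree. [folklore] -/
theorem num_eq_of_div_eq_div {k l p q : ℕ} (hl : 0 < l) (hq : 0 < q) (hkl : Nat.Coprime k l) (hpq : Nat.Coprime p q)
    (h : (k : ℚ) / l = p / q) : k = p := by
  rw [div_eq_div_iff (by exact_mod_cast hl.ne') (by exact_mod_cast hq.ne')] at h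
  have h' : k * q = p * l := by exact_mod_cast h
  apply Nat.dvd_antisymm
  · have : k ∣ p * l := ⟨q, h'.symm⟩
    exact hkl.dvd_of_dvd_mul_right this
  · have : p ∣ k * q := ⟨l, h'⟩
    exact hpq.dvd_of_dvd_mul_right this

/-- **Jozsa's recovery through the list of numerators**: under the hypotheses of Lemma 2
(`q ≥ 3S²`, `1 ≤ k, l ≤ S`, `gcd(k,l) = 1`, samples `c, d` within `1/2` of `kq/S`, `lq/S`), some
numerator `p` listed for `c/d` with fuel `2s + 1` (`d < 2ˢ`) satisfies `|S − round(pq/c)| < 1`.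
[cite: Jozsa2003, §10 (proof of Thm. 6)] [cite: HardyWright2008, Thm. 184] -/
theorem exists_mem_numsOf_round {S : ℝ} {q k l s : ℕ} {c d : ℤ} (hS : 1 ≤ S) (hq : 3 * S ^ 2 ≤ q)
    (hk : 1 ≤ k) (hkS : (k : ℝ) ≤ S) (hl : 1 ≤ l) (hlS : (l : ℝ) ≤ S) (hcop : Nat.Coprime k l)
    (hc : |(c : ℝ) - k * q / S| ≤ 1 / 2) (hd : |(d : ℝ) - l * q / S| ≤ 1 / 2) (hds : d.toNat < 2 ^ s) :
    ∃ p ∈ numsOf (quots c.toNat d.toNat (2 * s + 1)), |S - round ((p : ℝ) * q / c)| < 1 := by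
  have hcpos := IrrationalPeriod.sample_pos hS hq hk hc
  have hdpos := IrrationalPeriod.sample_pos hS hq hl hd
  have hcN : ((c.toNat : ℕ) : ℤ) = c := Int.toNat_of_nonneg hcpos.le
  have hdN : ((d.toNat : ℕ) : ℤ) = d := Int.toNat_of_nonneg hdpos.le
  have hd0 : 0 < d.toNat := by omega
  obtain ⟨n, hn⟩ := IrrationalPeriod.exists_convergent_eq hS hq hk hkS hl hlS hc hd
  -- the convergent index may be taken `≤ 2s`
  set n' := min n (2 * s) with hn'
  have hconv : ((k : ℚ) / l : ℚ) = natConv c.toNat d.toNat n' := by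
    have hcR : ((c.toNat : ℕ) : ℝ) = (c : ℝ) := by exact_mod_cast hcN
    have hdR : ((d.toNat : ℕ) : ℝ) = (d : ℝ) := by exact_mod_cast hdN
    have h1 : ((natConv c.toNat d.toNat n : ℚ) : ℝ) = Real.convergent ((c : ℝ) / d) n := by
      rw [natConv_eq_convergent hd0, hcR, hdR]
    have h2 : natConv c.toNat d.toNat n = natConv c.toNat d.toNat n' := by
      rcases le_total n (2 * s) with h | h
      · rw [hn', min_eq_left h]
      · rw [hn', min_eq_right h]; exact natConv_eq_of_le hd0 hds h
    have : (((k : ℚ) / l : ℚ) : ℝ) = ((natConv c.toNat d.toNat n : ℚ) : ℝ) := by rw [h1, ← hn]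
    rw [← h2]
    exact_mod_cast this
  rw [natConv_eq_evalFrac hd0] at hconv
  have hqpos := evalFrac_quots_snd_pos hd0 c.toNat n'
  have hkp : k = (evalFrac (quots c.toNat d.toNat (n' + 1))).1 :=
    num_eq_of_div_eq_div (by omega) hqpos hcop (evalFrac_coprime _) hconv
  refine ⟨(evalFrac (quots c.toNat d.toNat (n' + 1))).1, ?_, ?_⟩
  · -- it is the numerator of the nonempty prefix `quots c d (n'+1)` of `quots c d (2s+1)`
    rw [← cfFwd_eq_evalFrac] 
    refine mem_numsOf_of_prefix ?_ ?_
    · rw [← take_quots (2 * s + 1) (n' + 1) c.toNat d.toNat (by omega)]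
      exact List.take_prefix _ _
    · rw [quots_succ_of_pos hd0]; exact List.cons_ne_nil _ _
  · rw [← hkp]
    have := IrrationalPeriod.abs_sub_round_lt_one hS hq hk hc
    simpa using this

end PeriodFinding

end Literature.Computability.Cryptography

end
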